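import Summits.ResolutionOfSingularities.ResolutionOfSingularities.Theorems.InvariantDescentLU
import Literature.RingTheory.RegularLocalRing.KiralyLutkebohmertInvariantsRegular
import HarnessLib

/-!
# WildReflectionLU — decomp-res node «ReflectionCut» (lens-1 g31, Door C (W-wild), critic pre-ruling 229a): the wild
`ℤ/p` PSEUDO-REFLECTION SUB-CELL, decided BY CITATION — the tree's [KiralyLutkebohmert2013, Thm. 2 (a) ⇒ (d)] at a
valuation centre, the cell `WildPseudoReflectionLUAbove k O`, the hypothesis-free law
`relLU_of_wildPseudoReflectionLUAbove`, and the exact re-location `R31 ↔ R32` of the located residual with ROOT BY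
NAME `closes_wild`

THESIS.  Door (W-wild) of the critic's ledger (rows 187 / 213 / 229) asks for the wild quotient axis: every relative
cell of the programme so far (g25 tame-quotient, g26 abelian, g27 residue-free witness, g28 decomposition / inert
descent, g29 two-storey tame, g30 monomial blow-up) is TAME or UNRAMIFIED at the inertia level; a wild inertia group
(`p | #G_T`) was never consumed, because wild quotients of regular local rings are singular in general (Artin 1975;
the actions «ramified precisely at the origin» of Lorenzini–Schröer).  NOT ALWAYS: Király–Lütkebohmert
([KiralyLutkebohmert2013] = Algebra Number Theory 7 (2013) 63–74 = arXiv:1001.1945, Thm. 2 (a) ⇒ (d)) prove that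
for a cyclic group `G = ⟨σ⟩` of prime order `p` acting on a regular local ring `B`, `B^G` IS REGULAR as soon as the
AUGMENTATION IDEAL `I_G = (σb − b : b ∈ B)·B` is PRINCIPAL, generated by `σy − y` for one `y` (equivalently, when
`B` and `B^G` have the same residue field, `G` acts as a PSEUDO-REFLECTION, KL Def. 1 / Thm. 2 (a) ⇔ (e); in
Lorenzini–Schröer's words, Rem. 6.20, `(σ − id)(B) = (σy − y)·B`: the fixed scheme of `σ` is an effective Cartier
divisor).  The converse (`B^G` regular ⇒ `I_G` principal) is KL's Conjecture 10 (arXiv numbering; Conj. 9 in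
print), proved there for `p ≤ 3` and in dimension `≤ 1`, and by Serre in the tame case.  THIS THEOREM IS IN THE
TREE: `Literature.RingTheory.RegularLocalRing.KiralyLutkebohmert2013_thm2_holds` (Type 0) and the universe-polymorphic
`Literature.AlgebraicGeometry.Resolution.KiralyLutkebohmert2013_thm2_regular_of_isPrincipal …_first_holds
…_second_holds` (sorry-free, standard axioms).  This file REUSES it BY NAME (no re-proof) at a VALUATION CENTRE, in
every dimension and every characteristic, with zero fact binders, and cuts the corresponding kind out of the located
residual.  TERMINOLOGY: «pseudo-reflection» (PR) is used in LS's sense (Rem. 6.20 = [KiralyLutkebohmert2013] p. 64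
«I_G principal»), which for `G = ℤ/p` is KL's condition (a) with a named generator; LS's «moderately ramified»
(Def. 6.9: ramified precisely at the origin, structure Thm. 6.10) names the OPPOSITE geometry and is never meant
here.

PART A — THE ENGINE `isRegularLocalRing_locAtCentre_inf_fixed_of_isPrincipal` (frame as `InvariantDescentLU`): a
field `E` with a valuation ring `O_E`; a finite set `H` of ring automorphisms of `E` closed under composition and
containing `1`, PRESERVING `O_E` (one centre); its fixed subfield `K = E^H`; an `H`-stable subring `T₁ ⊆ O_E`
REGULAR at the centre of `O_E` (`B := (T₁)_𝔪′`).  Datum: `σ ∈ H` of prime order `p` with `E^σ ⊆ K`, `y ∈ T₁` with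
`σ y ≠ y` an AUGMENTATION GENERATOR for `σ` on `T₁`: `σ b − b ∈ (σ y − y) · B` for all `b ∈ T₁`.  Conclusion:
`T₁ ∩ K` is regular at the centre.  Proof = GLUE ONLY: restrict `σ` to a ring automorphism `σ_B` of `B`
(`apply_mem_locAtCentre`, `σ⁻¹ = σ^{p−1}`); `σ_B ≠ 1`, `σ_B^p = 1`; the augmentation ideal of `B` is principal,
generated by `σ y − y` (QUOTIENT RULE `exists_apply_sub_eq_mul_of_mem_locAtCentre`, KL Rem. 3); the TREE THEOREM
[KiralyLutkebohmert2013, Thm. 2] makes `B^{σ_B}` regular; `B^{σ_B} ≅ (T₁ ∩ K)_𝔪` (`⊆` by the landed norm trick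
`InvariantDescentLU.mem_locAtCentre_inf_of_fixed`, `⊇` trivially), and `IsRegularLocalRing.of_ringEquiv` concludes.

PART B — THE CELL AND THE LAW (summit frame `k ⊆ K`, `O : ValuationSubring K`).  `WildPseudoReflectionLUAbove k O`:
a Galois extension `K′ | K` inside `K̄` of PRIME degree `ℓ` with `(ℓ : k) = 0` (so `ℓ = p = char k`: Artin–Schreier,
`G = ℤ/p`), a `G`-STABLE valuation ring `O′` of `K′` above `O` (`G = G_Z`), and the STANDARD MODEL CLAUSE of the tame
cells with the PR clause inside the same `∃`: every finitely generated birational model `R ⊆ O` of `K` lies under a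
`G`-stable finitely generated model `M = ι(R)[t₀] ⊆ O′`, REGULAR at the centre of `O′`, carrying a PR generator —
`g ∈ G`, `y ∈ M`, `g y ≠ y`, `g b − b ∈ (g y − y)·M_𝔪′` for all `b ∈ M`.  THE LAW
`relLU_of_wildPseudoReflectionLUAbove : WildPseudoReflectionLUAbove k O → RelLocalUniformization k K O`
(HYPOTHESIS-FREE, every `d`, every `p`): `g ≠ 1` generates `G` (prime order, `mem_powers_of_prime_card`), so
`K′^g = ι(K)`; the engine with `E := K′`, `H := G`, `T₁ := M` gives `M ∩ ι(K)` regular at the centre of `O`;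
`M ∩ ι(K) ⊇ ι(R)` is finitely generated (`InvariantDescentLU2.exists_finset_inf_fixed_eq_closure`, Artin–Tate) and
transports to a model `A ⊇ R` of `K` inside `O` (`TameTwoStoreyLU.relLU_transport`).  The clause `(ℓ : k) = 0` is
NOT used by the proof ([KiralyLutkebohmert2013] is characteristic-free; the tame prime-degree PR descent is Serre /
[CossartPiltant2008, Prop. 9.4], the tame axis' closing step, in the tree as
`Literature.AlgebraicGeometry.Resolution.isRegularLocalRing_of_fixed_pseudoReflection`, `TameCyclicInvariants.lean`): it only LOCATES the cell on the wild axis.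

PART C — THE CUT.  `R32 := NonKHToricArchLUKeyHenselDescentQuotTInertTwoMBWild e c n` = R31
(`MonomialBlowupLU.NonKHToricArchLUKeyHenselDescentQuotTInertTwoMB`, landed `…MonomialBlowupLU4`) with the extra
binder `¬ WildPseudoReflectionLUAbove k O`; the cell piece `…MBWildCell` is DECIDED by the law (`_holds`); THE CUT
`nonKHToricArchLUKeyHenselDescentQuotTInertTwoMB_iff_wild : R31 ↔ R32` (exact, hypothesis-free), the re-locations
`R30/R29/R28/R25/R23/NonKHToricArchLU ↔ R32`, `closes_wild` = ROOT BY NAME with `closes_mb`'s binders and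
`R31 ↦ R32`, `root_iff_wild_sigma`.

COSTUME DIFF (the cell is NOT a rename of a landed cell).  vs `TameEquivariantLUAbove` (g25) / `TameAbelian…` (g26):
those demand `(ℓ : k) ≠ 0` and `μ_ℓ ⊆ k` — here `(ℓ : k) = 0`, the OPPOSITE sign condition, no root of unity, no
diagonalisation (a unipotent `σ` has the single eigenvalue `1`); vs `UnramifiedWitnessLUAbove` (g27) /
`DecompositionFieldLUAbove` (g28): those are the `G_T = 1` kinds (unit node differences, étale descent) — here
`G_T = G` is allowed and is the point; vs `TameInertialLUAbove` / `TameOverInertLUAbove` (g29): `p ∤ #G_T` there,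
`#G_T = p` here; vs `MonomialBlowupAbove` (g30): no blow-up, no exceptional divisor, no chart equation — the input is
a property of the action on ONE model.  The probes N1–N7 of `bc/Probe.lean` record that none of these cells hands the
new one back or forth cheaply.

ONE PAPER INSTANCE (every binder of the cell by hand; `d = 4`, `k = 𝔽_p`, any prime `p`).  ARC PLACE: choose
`ξ₁, ξ₂, ξ₃ ∈ t·𝔽_p⟦t⟧` algebraically independent over `𝔽_p(t)` (uncountably many), `K := 𝔽_p(t, y₁, y₂, y₃) ↪ 𝔽_p((t))`
by `y_i ↦ ξ_i`, `O := K ∩ 𝔽_p⟦t⟧`: discrete of rank one (`v(t) = 1`), residue field `𝔽_p` (residues algebraic ✓,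
`CharP` ✓), rational rank `1` + `trdeg κ = 0 < 4` ⇒ NOT Abhyankar ✓, `trdeg = 4` ✓.  WILD TOP: `K′ := K(θ)`,
`θ^p − θ = 1/t` (irreducible: `v(1/t) = −1`, `p ∤ 1`), Galois, `G = ⟨σ⟩ ≅ ℤ/p`, `σθ = θ + 1`, `[K′:K] = p`,
`(p : 𝔽_p) = 0` ✓.  With `π := 1/θ`: `t = π^p/(1 − π^{p−1})`, `K′ ↪ 𝔽_p((π))` totally ramified over `𝔽_p((t))`,
`O′ := K′ ∩ 𝔽_p⟦π⟧`, `O′ ∩ K = O` ✓, ONE prime above `O` (`e = p`, `f = 1`, defectless: `G = G_Z = G_T`, genuinely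
wild), so `O′` is `G`-stable ✓; `σπ = π/(1 + π)`, `σπ − π = −π²/(1+π)`, `v′(σπ − π) = 2`.  MODELS: put
`z_{i,N} := (y_i − Σ_{j<N} ξ_{i,j} t^j)/t^N ∈ O` and `R_N := 𝔽_p[t, z_{1,N}, z_{2,N}, z_{3,N}]` (a polynomial ring;
centre `(t, z_{i,N} − ξ_{i,N})`); `O = ⋃_N (R_N)_{centre}` (for `g ∈ 𝔽_p[t, y]` with `ord_t g(t, ξ) = m < N`,
`g = t^m·(unit of (R_N)_{centre})`).  Given ANY f.g. birational `R ⊆ O`, pick `N` with `R ⊆ (R_N)_{centre}`, a common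
denominator `s ∈ R_N ∖ centre`, and `t₀ := {ι(t), ι(z_{i,N}), ι(1/s), π} ∪ {(1 + jπ)⁻¹ : j ∈ 𝔽_p^×}`.  Then
`M := ι(R)[t₀] = ι(R_N)[1/s][π, (1+jπ)⁻¹] = 𝔽_p[z_{1,N}, z_{2,N}, z_{3,N}, π][1/s, (1+jπ)⁻¹]` (`t ∈ 𝔽_p[π, (1+jπ)⁻¹]`
because `∏_{j≠0}(1 + jπ) = 1 − π^{p−1}`): a LOCALISATION OF A POLYNOMIAL RING, so regular at the centre
`(π, z_{i,N} − ξ_{i,N})` ✓ (height 4, residue field `𝔽_p`); `M ⊆ O′` ✓; `G`-stable ✓ (`σ` fixes `z_{i,N}, s`,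
`σπ = π·(1+π)⁻¹`, `σ(1+jπ)⁻¹ = (1+π)(1+(j+1)π)⁻¹`); PR ✓: every `b ∈ M` is `F(π)` with `F ∈ 𝔽_p[z, 1/s](X)` having
denominators `∏(1 + jX)^{n_j}`, and `F(σπ) − F(π) = (σπ − π)·ΔF(σπ, π)` with `ΔF` in `M_𝔪′` (its denominators are
units at the centre) — `y := π`, `g := σ`.  (Sanity: `M^G ⊇ 𝔽_p[z, t][1/s]` is regular, as Thm. 2 (a) ⇒ (d)
predicts; the fixed scheme of `σ` on `Spec M_𝔪′` is the Cartier divisor `π² = 0`.)  Scope of the instance: it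
certifies INHABITATION of the cell by a genuinely wild top (`e = p`, `G = G_Z = G_T`, rank 1, `κ = k`, `trdeg 4`,
non-Abhyankar, PR charts cofinal) and the meaning of every clause; the place `O` itself is already uniformised by the
`R_N` (row 223c (iii): an instance is not progress on the root).

REGISTRY DATA (notice (5) and the critic's rider 229a (n4), said by hand; rational rank 2).  `K₀ := k(u, x₃, x₄)`
with an arc valuation `v₀` (`u ↦ t`; `A₀ := k[u, z′, z″]_{centre}` the arc charts as above, regular of dimension 3,
containing any prescribed finite subset of `O₀` with its `v₀`-units as units — no trdeg-3 floor needed);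
`K′ := K₀(η)`, `v′(Σ aᵢηⁱ) := minᵢ (v₀(aᵢ) + iγ)`, `γ ∉ ℚ`, `0 < γ < 1` (monomial: rank 1, `Γ′ = ℤ + ℤγ`, `κ = k`);
`σ : η ↦ η/(1+η)` over `K₀` (order `p`; `v′ ∘ σ = v′` by distinct dominant values); `K := K′^σ = K₀(s)`,
`s = η^p/(1 − η^{p−1})`, `v′|_K` monomial in `s` with `Γ_K = ℤ + pγℤ`: `e = p`, `f = g = 1`, DEFECTLESS,
`G = G_Z = G_T`, `trdeg 4 > rr 2`: non-Abhyankar.  Along `v′` the quadratic transforms of `k[u, η]_{(u,η)}` are the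
Perron charts `k[m₁, m₂]_{(m₁,m₂)}`, `m_i = u^{a_i} η^{−ε_i b_i}` with `b₁, b₂ ≥ 0` consecutive CONTINUANTS
(denominators of the convergents / intermediate fractions of `γ`), `u, η` non-negative monomials in `m₁, m₂`, and
`η = m₁^{α′} m₂^{β′}` with `α′, β′ ≥ 1` from the second step on.  For `R ∋` (w.l.o.g.) `u, s` f.g. in `O`:
`B := A₀[m₁, m₂]_{centre} = k[z′, z″, m₁, m₂]_{(x′, x″, m₁, m₂)}` is REGULAR of dimension 4 and contains `ι(R)` for
the chart index `n ≫ 0` (write each generator as `P(η)/Q(η)` over `K₀`, coefficients `u^{e}·w` with `w^{±1} ∈ A₀`;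
DOMINANT-TERM FACTORISATION `Q = w u^{e₀} η^{i₀}·(1 + Σ` monomials of positive value`)`, the bracket a unit of `B`
once those monomials are non-negative in `m₁, m₂`); `M := ι(R)[A₀-generators, m₁, m₂, (1 + jη)⁻¹ (j ∈ 𝔽_p^×)]` has
`M_𝔪′ = B`, lies in `O′`, and is `G`-STABLE: `σ m_i = m_i (1+η)^{∓b_i}`, `σ(1+jη)⁻¹ = (1+η)(1+(j+1)η)⁻¹`, `σ` fixes
`ι(R)` and `A₀`.  AUGMENTATIONS (`I := σ − id`): `I(ι(R)) = I(A₀) = 0`; `I(m_i) = m_i((1+η)^{∓b_i} − 1) ∈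
m_i·η^{p^{v_p(b_i)}}·B^×` (Frobenius: `(1+η)^{p^e b′} = (1 + η^{p^e})^{b′}`, `p ∤ b′`; `I(m_i) = 0` if `b_i = 0`);
`I((1+jη)⁻¹) = jη²·((1+jη)(1+(j+1)η))⁻¹ ∈ η²·B^×`; and for every `b ∈ M`, by the DERIVATION RULE
`I(ab) = I(a)·σ(b) + a·I(b)` (with `σ(M) ⊆ M ⊆ B`), `I(b) ∈ J := (I(m₁), I(m₂), η²)·B`.  PRINCIPALITY: if `p ∤ b₁`
and `p | b₂` (`p^e ∥ b₂`, `e ≥ 1`) then `I(m₁) = m₁η·unit`, `η² ∈ m₁ηB` (`η = m₁^{α′}m₂^{β′}`, `α′ ≥ 1`) and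
`I(m₂) ∈ m₂η^{p^e}B ⊆ m₁ηB` (`p^e − 1 ≥ 1`), so `J = I(m₁)·B` and `y := m₁` is a PR generator ✓ (symmetrically
`y := m₂` if `p | b₁`); if `p ∤ b₁b₂` then `J = η·(m₁, m₂)·B` is NOT principal — the chart is not PR.  Since
`gcd(b₁, b₂) = 1`, a Perron chart is PR iff `p` divides one of its two continuants.  GOLDEN `γ = (√5 − 1)/2`
(continuants = Fibonacci numbers): every prime divides infinitely many Fibonacci numbers (rank of apparition), so PR
charts are COFINAL and the cell is INHABITED by this rr-2 top for every `p` ✓.  CONTROL (the PR clause is a genuine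
condition on the top): call `γ` «`p`-unlucky» if no continuant of `γ` is divisible by `p`.  Residue dynamics
(`r_j := q_{j−1}/q_j mod p`, `r ↦ 1/(r + a)`, admissible iff `a < (−r mod p)`): for `p = 2` and `p = 3` NO irrational
`γ` is unlucky (PR charts are cofinal for every such top); for `p = 5`, `γ = [0; 3, 1, 1, 1, …]` (continuants
`1, 2, 3, 4, 7, 11, 18, 29, … ≡ 1, 2, 3, 4, 2, 1, 3, 4, 2, 1, …`, the Lucas tail, never `0 mod 5`) and for `p = 7`,
`γ = [0; 4, 2, 2, 2, …]` (continuants `1, 2, 3, 4, 5, 9, 13, 22, 31, 53, 75, 128, … ≡ 1, 2, 3, 4, 5, 2, 6, 1, 3, 4, 5, 2, …`,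
ratio `q_{j−1}/q_j ≡ 2`, `a = 2` for ever, never `0 mod 7`) ARE unlucky: then NO
regular local ring of `K′ = k(u, η)·K₀` of the form `A₀[`chart`]` is PR, and in the `d = 2` toy (`K₀ = k(u)`)
no `G`-stable regular model of `K′` above `k[u, s]` at all is PR (every 2-dimensional regular local ring of `k(u,η)`
dominating `k[u,η]_{(u,η)}` along `v′` is an iterated quadratic transform = a Perron chart: Abhyankar, Amer. J.
Math. 78 (1956), Thm. 3), while
`RelLocalUniformization` holds there anyway (Abhyankar place, MAP Π₀).  So the PR clause cuts a PROPER SUB-CELL out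
of the wild `ℤ/p` kind with log-diagonal action — the critic's reason for pricing this node 0 and for the door
(W-wild-PROD) of letter 229a (a PRODUCTION law for the log-diagonal wild kind, PR charts produced by the kernel).

HONEST SCOPE (critic 229a (n3), said openly; probes CW-5 / CW-6 / N5).  (1) This cell is a SUB-CELL of the wild
`ℤ/p` kind, cut out by a MODEL-SIDE clause (KL (a) = a regularity surrogate for the quotient): the PRODUCTION of PR
regular `G`-models upstairs — where the wild difficulty lives, by the CONTROL above — is ASSUMED, not proved; the
descent itself is decided by CITATION ([KiralyLutkebohmert2013, Thm. 2], tree theorem), not by new kernel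
mathematics.  (2) The law's conclusion `RelLocalUniformization k K O` is EQUIVALENT to the landed g27 cell
(`InertDescentLU5.unramifiedWitnessLUAbove_iff_relLU`), so R31's binder `¬ UnramifiedWitnessLUAbove k O` already
implies `¬ WildPseudoReflectionLUAbove k O` (`not_wildPseudoReflectionLUAbove_of_not_unramifiedWitnessLUAbove`): the
cut `R31 ↔ R32` is exact and hypothesis-free but the CLASS of places is unchanged — what moved is only the LOCATION
of the difficulty on the wild axis.  (3) COMPLEMENT inside the wild `ℤ/p` kind ⊇ {no PR regular `G`-model cofinal}
∋ the CONTROL tops (RelLU there by Π₀ when Abhyankar) and the wild quotient SINGULARITIES with fixed locus of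
codimension `c ≥ 2` at the centre (isolated fixed points = LS's «moderately ramified» actions, Def. 6.9 / Thm. 6.10;
Artin 1975), whose resolution is Hironaka-strength: in print for `d = 3` only ([CossartPiltant2019], inside the
floor), OPEN for `d ≥ 4` — named in R32's docstring as remainder (β′), not claimed; NON-cyclic `p`-inertia `(ℤ/p)^r`
is remainder (β″).  (4) No `TheoremD k` binder (`AdaptedChartHensel.TheoremD`, the «mod D» currency NEXT-g26/27
expected for (W-wild)): the law is hypothesis-free in every `d`; `closes_wild` carries exactly the five printed binders
of `closes_mb`.

TAGS (D-0178): ENGINE + LAW = DECIDED (kernel, hypothesis-free, axioms `propext · Classical.choice · Quot.sound`;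
engine = tree theorem BY NAME + glue); cell `WildPseudoReflectionLUAbove` = DECIDED PIECE (WEAKER than the root;
INHABITED: the arc instance and the golden rr-2 instance above); R32 = UNDECIDED located remainder (WEAKER than the
root, same class as R31); the cut `R31 ↔ R32` = DECIDED; `closes_wild` = ROOT BY NAME (COSTUME-free: the printed
binders of `closes_mb`).  WHAT IS NEW / WHAT IS NOT (one sentence): new are the TYPED wild PR sub-cell in the summit
frame, its hypothesis-free law in every dimension, the exact re-location `R31 ↔ R32` with root by name, the valuation
glue (restriction of `σ` to `(T₁)_𝔪′`, quotient rule, `B^σ ≅ (T₁ ∩ K)_𝔪`) and the certified instances / control;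
NOT new is the descent theorem itself ([KiralyLutkebohmert2013, Thm. 2], reused from the tree) — the node opens the
wild axis of the registry as a banked sub-cell at price 0 (pre-ruling 229a), it does not pay the (W-wild) door.

Sources: [KiralyLutkebohmert2013] = F. Király, W. Lütkebohmert, Algebra Number Theory 7 (2013) 63–74 =
arXiv:1001.1945 (arXiv numbering: Def. 1, Thm. 2, Rem. 3, Lemma 4, Prop. 5, Conj. 10), tree files
`Literature/RingTheory/RegularLocalRing/KiralyLutkebohmert{,InvariantsRegular}.lean`,
`Literature/AlgebraicGeometry/Resolution/KiralyLutkebohmertCriterion{,Proofs}.lean`; Lorenzini–Schröer 2020, Math.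
Z. 295 (doi:10.1007/s00209-019-02408-4 = arXiv:1904.08371) Rem. 6.20 (pseudo-reflections), Def. 6.9 / Thm. 6.10
(the opposite, isolated-fixed-point class), Prop. 6.21 (Serre's necessity via generalized reflections), p. 27;
Artin 1975 (doi:10.2307/2040100); Abhyankar, Amer. J. Math. 78 (1956) 321–348, Thm. 3 (a 2-dimensional regular
local ring birationally dominating another is an iterated quadratic transform of it);
[CossartPiltant2008, Prop. 9.4]; [CossartPiltant2019, §4.1] (models `S[t]`); Atiyah–Macdonald Prop. 7.8 via
`InvariantDescentLU2`.  Hygiene: no Literature fact stated or ported (one Literature THEOREM imported and called by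
name), no `instance` / `notation` / `macro`, no attribute removal, sorry-free, no kit, no harness import;
`set_option maxHeartbeats … in` stands BEFORE the docstring of each heavy theorem — keep it when slicing.
-/

noncomputable section

open Literature.AlgebraicGeometry.Resolution
open Summit.ResolutionOfSingularities.ResolutionOfSingularities.Theorems.InertDescentLU
open Summit.ResolutionOfSingularities.ResolutionOfSingularities.Theorems.InvariantDescentLU

universe u

namespace Summit.ResolutionOfSingularities.ResolutionOfSingularities.Theorems.WildReflectionLU

variable {E : Type u} [Field E]

/-! ## PART A — THE ENGINE: [KiralyLutkebohmert2013, Thm. 2 (a) ⇒ (d)] BY NAME at the centre of a valuation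

The tree's `Literature.AlgebraicGeometry.Resolution.KiralyLutkebohmert2013_thm2_regular_of_isPrincipal`
(with the discharged `KiralyLutkebohmert2013_thm2_first_holds` / `…_second_holds`; Type-0 form
`Literature.RingTheory.RegularLocalRing.KiralyLutkebohmert2013_thm2_holds`) — «`B` regular local, `σ` a ring
automorphism of prime order `p` with principal augmentation ideal ⇒ the invariant subring `B^σ` is regular local» —
is applied to `B := (T₁)_𝔪′ = locAtCentre T₁ O_E` and the restriction `σ_B` of `σ`; the invariant ring `B^{σ_B}` is
identified with the local ring `(T₁ ∩ K)_𝔪` of the invariant model by the landed norm trick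
`InvariantDescentLU.mem_locAtCentre_inf_of_fixed`, and regularity is transported along that ring isomorphism
(`IsRegularLocalRing.of_ringEquiv`).  NO part of [KiralyLutkebohmert2013] is re-proved here. -/

section Stab

variable (OE : ValuationSubring E) {T : Subring E} {σ : E ≃+* E}

/-- An automorphism of `E` preserving `O_E` and `T` preserves the local ring `T_𝔪′` of `T` at the centre of `O_E`.
[folklore] -/
theorem apply_mem_locAtCentre (hσO : ∀ z : E, z ∈ OE ↔ σ z ∈ OE) (hσT : ∀ z ∈ T, σ z ∈ T) {b : E}
    (hb : b ∈ locAtCentre T OE) : σ b ∈ locAtCentre T OE := by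
  obtain ⟨a, ha, s, hs, hsv, rfl⟩ := mem_locAtCentre_iff.mp hb
  exact ⟨σ a, hσT a ha, σ s, hσT s hs, valuation_apply_eq_one OE hσO hsv, by rw [map_div₀]⟩

/-- … and so does every power of it. [folklore] -/
theorem pow_apply_mem_locAtCentre (hσO : ∀ z : E, z ∈ OE ↔ σ z ∈ OE) (hσT : ∀ z ∈ T, σ z ∈ T) (j : ℕ)
    {b : E} (hb : b ∈ locAtCentre T OE) : (σ ^ j) b ∈ locAtCentre T OE := by
  induction j with
  | zero => rwa [pow_zero, RingAut.one_apply]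
  | succ j ih => rw [pow_succ', RingAut.mul_apply]; exact apply_mem_locAtCentre OE hσO hσT ih

/-- QUOTIENT RULE: an augmentation generator `y` for `σ` on `T` — `σ b − b ∈ (σ y − y)·T_𝔪′` for `b ∈ T` — is one
on the local ring `T_𝔪′` (for `b = a/s` with `s` a unit at the centre,
`σ(a/s) − a/s = (σy − y)·(c_a s − a c_s)/(s·σ s)`).  [cite: KiralyLutkebohmert2013, Rem. 3, p. 65] -/
theorem exists_apply_sub_eq_mul_of_mem_locAtCentre (hσO : ∀ z : E, z ∈ OE ↔ σ z ∈ OE)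
    (hσT : ∀ z ∈ T, σ z ∈ T) {y : E} (hPR : ∀ b ∈ T, ∃ c ∈ locAtCentre T OE, σ b - b = (σ y - y) * c)
    {b : E} (hb : b ∈ locAtCentre T OE) : ∃ c ∈ locAtCentre T OE, σ b - b = (σ y - y) * c := by
  set B : Subring E := locAtCentre T OE with hBdef
  obtain ⟨a, ha, s, hs, hsv, rfl⟩ := mem_locAtCentre_iff.mp hb
  obtain ⟨ca, hca, hcae⟩ := hPR a ha
  obtain ⟨cs, hcs, hcse⟩ := hPR s hs
  have hs0 : s ≠ 0 := ne_zero_of_valuation_eq_one hsv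
  have hσsv : OE.valuation (σ s) = 1 := valuation_apply_eq_one OE hσO hsv
  have hσs0 : σ s ≠ 0 := ne_zero_of_valuation_eq_one hσsv
  refine ⟨(ca * s - a * cs) * (σ s * s)⁻¹,
    B.mul_mem (B.sub_mem (B.mul_mem hca (le_locAtCentre _ _ hs)) (B.mul_mem (le_locAtCentre _ _ ha) hcs))
      (inv_mem_locAtCentre (le_locAtCentre _ _ (T.mul_mem (hσT s hs) hs))
        (by rw [map_mul, hσsv, hsv, mul_one])), ?_⟩
  have e1 : σ a = a + (σ y - y) * ca := by rw [← hcae]; ring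
  have e2 : σ s = s + (σ y - y) * cs := by rw [← hcse]; ring
  have hσs0' : s + (σ y - y) * cs ≠ 0 := e2 ▸ hσs0
  rw [map_div₀, e1, e2]
  field_simp
  ring

end Stab

section Main

variable (OE : ValuationSubring E) (H : Finset (E ≃+* E)) (K : Subfield E) (T₁ : Subring E)

set_option maxHeartbeats 800000 in
/-- **THE ENGINE — Király–Lütkebohmert Thm. 2 (a) ⇒ (d) at a valuation centre, BY NAME.**
Frame (as `InvariantDescentLU`): `H` a finite composition-closed set of automorphisms of the field `E` containing
`1` and PRESERVING `O_E` (one centre), `K = E^H` its fixed subfield, `T₁ ⊆ O_E` an `H`-stable subring whose local ring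
`B := (T₁)_𝔪′` at the centre of `O_E` is REGULAR.  Datum: `σ ∈ H` of prime order `p` with `E^σ ⊆ K` (so `σ`
generates `H` as far as invariants are concerned), and `y ∈ T₁` with `σ y ≠ y` an AUGMENTATION GENERATOR for `σ` on
`T₁`: `σ b − b ∈ (σ y − y)·B` for every `b ∈ T₁` (KL13 condition (a) with a named generator; a pseudo-reflection
in the sense of Lorenzini–Schröer Rem. 6.20).  THEN `(T₁ ∩ K)_𝔪` is a regular local ring.  Proof: restrict `σ` to
a ring automorphism `σ_B` of `B` (`apply_mem_locAtCentre`; `σ⁻¹ = σ^{p−1}`); `σ_B ≠ 1` (at `y`), `σ_B^p = 1`; its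
augmentation ideal is principal, generated by `σ y − y` (quotient rule
`exists_apply_sub_eq_mul_of_mem_locAtCentre`); the tree's
`KiralyLutkebohmert2013_thm2_regular_of_isPrincipal …first_holds …second_holds` makes the invariant subring
`B^{σ_B}` regular; and `B^{σ_B} ≅ (T₁ ∩ K)_𝔪` as rings — `⊇` because fractions of `H`-invariants are `σ`-invariant,
`⊆` by the landed norm trick `InvariantDescentLU.mem_locAtCentre_inf_of_fixed` (an element of `B` fixed by `σ`,
hence by `H`, is a fraction of invariants with unit denominator) — so `IsRegularLocalRing.of_ringEquiv` concludes.
[cite: KiralyLutkebohmert2013, Thm. 2 (a) ⇒ (d), pp. 64–65] [cite: LorenziniSchroer2019, Rem. 6.20] -/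
theorem isRegularLocalRing_locAtCentre_inf_fixed_of_isPrincipal (p : ℕ) (hp : p.Prime)
    (h1 : (1 : E ≃+* E) ∈ H) (hmul : ∀ g ∈ H, ∀ h ∈ H, g * h ∈ H)
    (hK : ∀ z, z ∈ K ↔ ∀ h ∈ H, h z = z)
    (hHO : ∀ h ∈ H, ∀ z : E, z ∈ OE ↔ h z ∈ OE) (hT₁O : T₁ ≤ OE.toSubring)
    (hT₁H : ∀ h ∈ H, ∀ z ∈ T₁, h z ∈ T₁) (hreg : IsRegularLocalRing (locAtCentre T₁ OE))
    {σ : E ≃+* E} (hσH : σ ∈ H) (hσp : σ ^ p = 1) (hσK : ∀ z, σ z = z → z ∈ K)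
    {y : E} (hy : y ∈ T₁) (hσy : σ y ≠ y)
    (hPR : ∀ b ∈ T₁, ∃ c ∈ locAtCentre T₁ OE, σ b - b = (σ y - y) * c) :
    IsRegularLocalRing (locAtCentre (T₁ ⊓ K.toSubring) OE) := by
  classical
  set B : Subring E := locAtCentre T₁ OE with hBdef
  haveI : IsRegularLocalRing B := hreg
  have hσO : ∀ z : E, z ∈ OE ↔ σ z ∈ OE := hHO σ hσH
  have hσT : ∀ z ∈ T₁, σ z ∈ T₁ := hT₁H σ hσH
  have hσB : ∀ b ∈ B, σ b ∈ B := fun b hb => apply_mem_locAtCentre OE hσO hσT hb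
  have hp1 : 1 ≤ p := hp.one_lt.le
  have hσinv : σ.symm = σ ^ (p - 1) := by
    have h : σ ^ (p - 1) * σ = 1 := by rw [← pow_succ, Nat.sub_add_cancel hp1, hσp]
    show σ⁻¹ = σ ^ (p - 1)
    exact inv_eq_of_mul_eq_one_left h
  have hσiB : ∀ b ∈ B, σ.symm b ∈ B := fun b hb => by
    rw [hσinv]; exact pow_apply_mem_locAtCentre OE hσO hσT (p - 1) hb
  -- the restricted automorphism `σ_B`
  let σB : B ≃+* B :=
    { toFun := fun b => ⟨σ b, hσB b b.2⟩
      invFun := fun b => ⟨σ.symm b, hσiB b b.2⟩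
      left_inv := fun b => Subtype.ext (σ.symm_apply_apply (b : E))
      right_inv := fun b => Subtype.ext (σ.apply_symm_apply (b : E))
      map_mul' := fun a b => Subtype.ext (map_mul σ (a : E) b)
      map_add' := fun a b => Subtype.ext (map_add σ (a : E) b) }
  have hσBcoe : ∀ b : B, ((σB b : B) : E) = σ b := fun _ => rfl
  have hσBpow : ∀ (n : ℕ) (b : B), (((σB ^ n) b : B) : E) = (σ ^ n) (b : E) := by
    intro n
    induction n with
    | zero => intro b; rw [pow_zero, pow_zero, RingAut.one_apply, RingAut.one_apply]
    | succ n ih => intro b; rw [pow_succ, pow_succ, RingAut.mul_apply, RingAut.mul_apply, ih (σB b), hσBcoe]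
  have hyB : y ∈ B := le_locAtCentre T₁ OE hy
  have hne : σB ≠ RingEquiv.refl B := by
    intro h
    exact hσy (congrArg Subtype.val (RingEquiv.congr_fun h ⟨y, hyB⟩))
  have hpow : σB ^ p = RingEquiv.refl B := by
    refine RingEquiv.ext fun b => Subtype.ext ?_
    rw [hσBpow, hσp, RingAut.one_apply]
    rfl
  -- (a): the augmentation ideal of `B` is principal, generated by `σ y − y`
  have hPRB : ∀ b ∈ B, ∃ c ∈ B, σ b - b = (σ y - y) * c := fun b hb =>
    exists_apply_sub_eq_mul_of_mem_locAtCentre OE hσO hσT hPR hb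
  have hprinc : (Ideal.span (Set.range fun b : B => σB b - b)).IsPrincipal := by
    refine ⟨⟨σB ⟨y, hyB⟩ - ⟨y, hyB⟩, le_antisymm ?_ ?_⟩⟩
    · rw [Ideal.span_le]
      rintro _ ⟨b, rfl⟩
      obtain ⟨c, hc, hce⟩ := hPRB b b.2
      refine Ideal.mem_span_singleton'.mpr ⟨⟨c, hc⟩, Subtype.ext ?_⟩
      show c * (σ y - y) = σ b - b
      rw [hce, mul_comm]
    · exact Ideal.span_mono (Set.singleton_subset_iff.mpr ⟨⟨y, hyB⟩, rfl⟩)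
  -- [KiralyLutkebohmert2013, Thm. 2 (a) ⇒ (d)] BY NAME
  have hKL : IsRegularLocalRing ((σB : B →+* B).eqLocus (RingHom.id B)) :=
    KiralyLutkebohmert2013_thm2_regular_of_isPrincipal KiralyLutkebohmert2013_thm2_first_holds
      KiralyLutkebohmert2013_thm2_second_holds p hp B σB hne hpow hprinc
  -- `B^σ ≅ (T₁ ∩ K)_𝔪`
  set A : Subring E := locAtCentre (T₁ ⊓ K.toSubring) OE with hAdef
  have hAB : A ≤ B := locAtCentre_mono OE inf_le_left
  have hfixH : ∀ z : E, σ z = z → ∀ h ∈ H, h z = z := fun z hz => (hK z).mp (hσK z hz)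
  have hmemA : ∀ b : B, σB b = b → (b : E) ∈ A := fun b hb =>
    mem_locAtCentre_inf_of_fixed OE h1 hmul hK hT₁O hT₁H b.2
      (hfixH _ (by simpa [hσBcoe] using congrArg Subtype.val hb))
  have hfixA : ∀ a ∈ A, σ a = a := by
    intro a ha
    obtain ⟨u, hu, s, hs, -, rfl⟩ := mem_locAtCentre_iff.mp ha
    have hu' : σ u = u := (hK u).mp (Subring.mem_inf.mp hu).2 σ hσH
    have hs' : σ s = s := (hK s).mp (Subring.mem_inf.mp hs).2 σ hσH
    rw [map_div₀, hu', hs']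
  let φ : ((σB : B →+* B).eqLocus (RingHom.id B)) →+* A :=
    { toFun := fun x => ⟨((x : B) : E), hmemA x x.2⟩
      map_one' := rfl
      map_mul' := fun _ _ => rfl
      map_zero' := rfl
      map_add' := fun _ _ => rfl }
  have hφbij : Function.Bijective φ := by
    constructor
    · intro x₁ x₂ h
      have h' : ((x₁ : B) : E) = ((x₂ : B) : E) := congrArg (fun a : A => (a : E)) h
      exact Subtype.ext (Subtype.ext h')
    · intro a
      refine ⟨⟨⟨a, hAB a.2⟩, ?_⟩, rfl⟩
      exact Subtype.ext (hfixA a a.2)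
  exact IsRegularLocalRing.of_ringEquiv (RingEquiv.ofBijective φ hφbij)

end Main

end Summit.ResolutionOfSingularities.ResolutionOfSingularities.Theorems.WildReflectionLU

end
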